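import Literature.NumberTheory.GaloisRepresentations.HasseNormEtaleInvolutionNorm
import HarnessLib

/-!
# The swapped pairs of factors of an étale algebra with a semilinear involution, adelically: the factor norm at `J` of the twisted
# projection is `σ_𝔸` of the factor norm at `τ⁻¹J`, and the ORBIT SPLIT of the product of all factor norms
# (Rogawski 1990 §3.5 Prop. 3.5.2 p. 29–30; Cassels–Fröhlich II §19, VII §7.1)

Topic `NumberTheory/GaloisRepresentations`; namespace `Literature.NumberTheory.GaloisRepresentations`.  THEOREMS ONLY (no definition, no
instance, no notation, no named fact); universe `Type`.  Sequel of ★ `HasseNormEtaleInvolutionNorm` ((Ⅱa): transfers `θ : 𝔸_F ⊗_F M ≅ 𝔸_L ⊗_L M`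
and `det (Ψ X) = ∏_𝔪 N_{𝔸_L}(θ_𝔪 ((1 ⊗ π_𝔪) X))`), row G6∕R6d «det-reading (Ⅱ)» of the floor-0 unitary stabilisation (engine T1, crux H413): the
PAIRS `{𝔪, τ𝔪}`, `τ𝔪 ≠ 𝔪`, of maximal ideals of the Cartan algebra `B = L[γ]` contribute `y · σ_𝔸(y)` to `det x_g` — an adelic norm from `L` — so
that only the `τ`-STABLE factors carry the obstruction (consumer: `HasseNormEtaleInvolutionNormDescent`, the HEAD `exists_prod_ideleRelNorm_fixedField_eq`
of R6d (C) `sum_cartanObsFun_eq_zero`).  Road lettered by A-p14 (g18) (`BLUEPRINT-det-reading`, (N2)–(N2′)).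

THE MATHEMATICS.  `F ⊆ L` number fields, `σ ∈ Aut(L∕F)` an involution, `σ_𝔸 = σ ⊗ 1` on `𝔸_L`; `M` a commutative `L`-algebra with an `F`-involution
`τ` that is `σ`-SEMILINEAR (`τ(ℓ m) = σ(ℓ) τ(m)`).  For an ideal `J` of `M`, `τ` induces an `F`-algebra isomorphism `τ̄ : M∕τ⁻¹J ≅ M∕J`, again
`σ`-semilinear, and hence a RING isomorphism `Θ := θ_J ∘ (1 ⊗ τ̄) ∘ θ_{τ⁻¹J}⁻¹ : 𝔸_L ⊗_L M∕τ⁻¹J ≅ 𝔸_L ⊗_L M∕J` which restricts to `σ_𝔸` on the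
scalars `𝔸_L` (checked on `ℓ · con(a)`, which span `𝔸_L = con(𝔸_F) · L`).  Mathlib's `Algebra.norm_eq_of_equiv_equiv` along the pair `(σ_𝔸, Θ)` gives
(§1) `N_{𝔸_L}(θ_J((1 ⊗ π_J)((1 ⊗ τ) X))) = σ_𝔸 (N_{𝔸_L}(θ_{τ⁻¹J}((1 ⊗ π_{τ⁻¹J}) X)))` — the norms at a swapped pair are `σ_𝔸`-CONJUGATE.  For a
`τ`-FIXED `X` (§2) the involution `𝔪 ↦ τ⁻¹𝔪` of `MaxSpec M` therefore satisfies `ν(τ⁻¹𝔪) = σ_𝔸 ν(𝔪)` for `ν(𝔪) := N_{𝔸_L}(θ_𝔪((1 ⊗ π_𝔪) X))`, and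
splitting `MaxSpec M` into the fixed points (the `τ`-stable `𝔪`, reindexed by any `e : ι ≃ {𝔪 ∣ τ⁻¹𝔪 = 𝔪}`) and the free orbits (halved by an
auxiliary linear order) yields `∏_𝔪 ν(𝔪) = (∏_i ν(e i)) · (y · σ_𝔸 y)`.

* §1 (N2) **`norm_transfer_comap_eq`**; §2 `prod_eq_prod_mul_mul_of_involutive` (the orbit split for any involution `c` of a finite type and any
  `ν` with `ν (c a) = φ (ν a)`, `φ` a monoid endomorphism), (N2′) **`exists_prod_norm_transfer_eq_prod_mul_mul_apply`**.

## References
* J. D. Rogawski, *Automorphic Representations of Unitary Groups in Three Variables*, Ann. of Math. Stud. 123 (1990), §3.5 Prop. 3.5.2 and p. 29–30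
  (the pairs `K_j ≅ K_{j′}` of the Cartan algebra carry no obstruction) [Rogawski1990].
* J. W. S. Cassels, A. Fröhlich (eds.), *Algebraic Number Theory* (1967), Ch. II (Cassels) §19 (19.1)–(19.7); Ch. VII (Tate) §7.1 [CasselsFrohlichANT1967].
-/

set_option autoImplicit false

noncomputable section

open scoped TensorProduct NumberField NumberField.AdeleRing

namespace Literature.NumberTheory.GaloisRepresentations

open NumberField IsDedekindDomain
open Literature.NumberTheory.AdelicBaseChange Literature.NumberTheory.Automorphic

/-! ## §1 (N2) The factor norms at a swapped pair are `σ_𝔸`-conjugate -/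

section Pairs

variable {F L : Type} [Field F] [NumberField F] [Field L] [NumberField L] [Algebra F L] (σ : L ≃ₐ[F] L)
  (σA : AdeleRing (𝓞 L) L →+* AdeleRing (𝓞 L) L) (hσA : ∀ z, σA z = σ • z)
  {M : Type} [CommRing M] [Algebra F M] [Algebra L M]
  (τ : M ≃ₐ[F] M) (hτσ : ∀ (ℓ : L) (m : M), τ (ℓ • m) = σ ℓ • τ m)

omit [NumberField F] in
include hσA in
/-- `σ_𝔸 ∘ σ_𝔸 = id` for an involution `σ`. [cite: CasselsFrohlichANT1967, Ch. VII §7.1] -/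
theorem ringHom_comp_self_eq_id (hσ : σ * σ = 1) : σA.comp σA = RingHom.id _ := by
  refine RingHom.ext fun z => ?_
  rw [RingHom.comp_apply, hσA, hσA, ← mul_smul, hσ, one_smul, RingHom.id_apply]

omit [NumberField F] [NumberField L] in
include hτσ in
/-- The induced isomorphism `τ̄ : M∕τ⁻¹J ≅ M∕J` (Mathlib `Ideal.quotientEquivAlg`) is `σ`-semilinear on the generator: `τ̄ (ℓ · 1) = σ(ℓ) · 1`.
[cite: CasselsFrohlichANT1967, Ch. VII §7.1] -/
theorem quotientEquivAlg_comap_smul_one (J : Ideal M) (hJ : J = (J.comap τ).map (τ : M →+* M)) (ℓ : L) :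
    Ideal.quotientEquivAlg (J.comap τ) J τ hJ (ℓ • (1 : M ⧸ J.comap τ)) = σ ℓ • (1 : M ⧸ J) := by
  have h1 : (ℓ • (1 : M ⧸ J.comap τ)) = Ideal.Quotient.mk (J.comap τ) (ℓ • 1) := by
    rw [← Ideal.Quotient.mkₐ_eq_mk L, map_smul, map_one]
  rw [h1, Ideal.quotientEquivAlg_mk, hτσ, map_one, ← Ideal.Quotient.mkₐ_eq_mk L, map_smul, map_one]

/-- **The twisted projection through `τ̄`**: `(1 ⊗ π_J)((1 ⊗ τ) X) = (1 ⊗ τ̄)((1 ⊗ π_{τ⁻¹J}) X)` (★ `map_mk_map_eq`, with the isomorphism `τ̄` in place of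
the induced homomorphism). [cite: CasselsFrohlichANT1967, Ch. VII §7.1] -/
theorem map_mk_map_eq_map_quotientEquivAlg (J : Ideal M) (hJ : J = (J.comap τ).map (τ : M →+* M)) (X : AdeleRing (𝓞 F) F ⊗[F] M) :
    Algebra.TensorProduct.map (AlgHom.id (AdeleRing (𝓞 F) F) (AdeleRing (𝓞 F) F)) (Ideal.Quotient.mkₐ F J)
        (Algebra.TensorProduct.map (AlgHom.id (AdeleRing (𝓞 F) F) (AdeleRing (𝓞 F) F)) (τ : M →ₐ[F] M) X) =
      Algebra.TensorProduct.map (AlgHom.id (AdeleRing (𝓞 F) F) (AdeleRing (𝓞 F) F))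
          (Ideal.quotientEquivAlg (J.comap τ) J τ hJ : (M ⧸ J.comap τ) →ₐ[F] M ⧸ J)
        (Algebra.TensorProduct.map (AlgHom.id (AdeleRing (𝓞 F) F) (AdeleRing (𝓞 F) F)) (Ideal.Quotient.mkₐ F (J.comap τ)) X) := by
  rw [← AlgHom.comp_apply, ← AlgHom.comp_apply, ← Algebra.TensorProduct.map_id_comp, ← Algebra.TensorProduct.map_id_comp]
  congr 2

include hσA hτσ in
/-- **(N2) THE FACTOR NORMS AT A SWAPPED PAIR ARE `σ_𝔸`-CONJUGATE.**  For any ideal `J` of `M` and any transfers `θ₁` (for `M∕τ⁻¹J`) and `θ₂` (for `M∕J`)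
with their values on pure tensors: `N_{𝔸_L}(θ₂((1 ⊗ π_J)((1 ⊗ τ) X))) = σ_𝔸 (N_{𝔸_L}(θ₁((1 ⊗ π_{τ⁻¹J}) X)))` — Mathlib `Algebra.norm_eq_of_equiv_equiv` along
`e₁ := σ_𝔸` (a ring automorphism of `𝔸_L`, `σ` an involution) and `e₂ := Θ := θ₂ ∘ (1 ⊗ τ̄) ∘ θ₁⁻¹`, which intertwine the `𝔸_L`-algebra structures because
`Θ(ℓ · con a ⊗ 1) = σ(ℓ) · con a ⊗ 1` (`τ̄` is `σ`-semilinear, `con a` is `σ`-fixed) and `ℓ · con a` span `𝔸_L` (★ `adeleRingTensorAlgEquiv F L`).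
[cite: Rogawski1990, §3.5 Prop. 3.5.2 p. 29–30] [cite: CasselsFrohlichANT1967, Ch. II §19 (19.1)–(19.7); Ch. VII §7.1] -/
theorem norm_transfer_comap_eq (hσ : σ * σ = 1) (J : Ideal M)
    (θ₁ : AdeleRing (𝓞 F) F ⊗[F] (M ⧸ J.comap τ) ≃+* AdeleRing (𝓞 L) L ⊗[L] (M ⧸ J.comap τ))
    (hθ₁ : ∀ (a : AdeleRing (𝓞 F) F) (m : M ⧸ J.comap τ), θ₁ (a ⊗ₜ m) = NumberField.AdeleRing.baseChange F L a ⊗ₜ m)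
    (θ₂ : AdeleRing (𝓞 F) F ⊗[F] (M ⧸ J) ≃+* AdeleRing (𝓞 L) L ⊗[L] (M ⧸ J))
    (hθ₂ : ∀ (a : AdeleRing (𝓞 F) F) (m : M ⧸ J), θ₂ (a ⊗ₜ m) = NumberField.AdeleRing.baseChange F L a ⊗ₜ m)
    (X : AdeleRing (𝓞 F) F ⊗[F] M) :
    Algebra.norm (AdeleRing (𝓞 L) L) (θ₂ (Algebra.TensorProduct.map (AlgHom.id (AdeleRing (𝓞 F) F) (AdeleRing (𝓞 F) F)) (Ideal.Quotient.mkₐ F J)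
        (Algebra.TensorProduct.map (AlgHom.id (AdeleRing (𝓞 F) F) (AdeleRing (𝓞 F) F)) (τ : M →ₐ[F] M) X))) =
      σA (Algebra.norm (AdeleRing (𝓞 L) L) (θ₁ (Algebra.TensorProduct.map (AlgHom.id (AdeleRing (𝓞 F) F) (AdeleRing (𝓞 F) F))
        (Ideal.Quotient.mkₐ F (J.comap τ)) X))) := by
  have hJ : J = (J.comap τ).map (τ : M →+* M) := (Ideal.map_comap_of_surjective (τ : M →+* M) τ.surjective J).symm
  have hσσ : ∀ z, σA (σA z) = z := fun z => by rw [hσA, hσA, ← mul_smul, hσ, one_smul]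
  -- `σ_𝔸` as a ring automorphism
  have hinv : σA.comp σA = RingHom.id _ := ringHom_comp_self_eq_id σ σA hσA hσ
  let e₁ : AdeleRing (𝓞 L) L ≃+* AdeleRing (𝓞 L) L := RingEquiv.ofRingHom σA σA hinv hinv
  -- `Θ := θ₂ ∘ (1 ⊗ τ̄) ∘ θ₁⁻¹`
  let Θ : AdeleRing (𝓞 L) L ⊗[L] (M ⧸ J.comap τ) ≃+* AdeleRing (𝓞 L) L ⊗[L] (M ⧸ J) :=
    (θ₁.symm.trans (Algebra.TensorProduct.congr (AlgEquiv.refl : AdeleRing (𝓞 F) F ≃ₐ[F] AdeleRing (𝓞 F) F)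
      (Ideal.quotientEquivAlg (J.comap τ) J τ hJ)).toRingEquiv).trans θ₂
  have hΘ : ∀ (a : AdeleRing (𝓞 F) F) (m : M ⧸ J.comap τ),
      Θ (NumberField.AdeleRing.baseChange F L a ⊗ₜ m) = NumberField.AdeleRing.baseChange F L a ⊗ₜ Ideal.quotientEquivAlg (J.comap τ) J τ hJ m := by
    intro a m
    change θ₂ (Algebra.TensorProduct.congr (AlgEquiv.refl : AdeleRing (𝓞 F) F ≃ₐ[F] AdeleRing (𝓞 F) F) (Ideal.quotientEquivAlg (J.comap τ) J τ hJ)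
      (θ₁.symm (NumberField.AdeleRing.baseChange F L a ⊗ₜ m))) = _
    rw [← hθ₁, RingEquiv.symm_apply_apply, Algebra.TensorProduct.congr_apply, Algebra.TensorProduct.map_tmul, hθ₂]
    rfl
  -- the intertwining of the `𝔸_L`-structures: check on `ℓ · con a`
  have he : (algebraMap (AdeleRing (𝓞 L) L) (AdeleRing (𝓞 L) L ⊗[L] (M ⧸ J))).comp (e₁ : AdeleRing (𝓞 L) L →+* AdeleRing (𝓞 L) L) =
      (Θ : AdeleRing (𝓞 L) L ⊗[L] (M ⧸ J.comap τ) →+* AdeleRing (𝓞 L) L ⊗[L] (M ⧸ J)).comp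
        (algebraMap (AdeleRing (𝓞 L) L) (AdeleRing (𝓞 L) L ⊗[L] (M ⧸ J.comap τ))) := by
    have hsurj : Function.Surjective ((adeleRingTensorAlgEquiv F L : AdeleRing (𝓞 F) F ⊗[F] L ≃ₐ[AdeleRing (𝓞 F) F] AdeleRing (𝓞 L) L) :
        AdeleRing (𝓞 F) F ⊗[F] L →+* AdeleRing (𝓞 L) L) := (adeleRingTensorAlgEquiv F L).surjective
    refine (RingHom.cancel_right hsurj).mp (RingHom.ext fun z => ?_)
    induction z using TensorProduct.induction_on with
    | zero => simp only [map_zero]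
    | add x y hx hy => simp only [map_add, hx, hy]
    | tmul a ℓ =>
        simp only [RingHom.coe_comp, Function.comp_apply]
        change algebraMap _ _ (e₁ (adeleRingTensorAlgEquiv F L (a ⊗ₜ ℓ))) = Θ (algebraMap _ _ (adeleRingTensorAlgEquiv F L (a ⊗ₜ ℓ)))
        rw [RingEquiv.ofRingHom_apply, adeleRingTensorAlgEquiv_tmul, map_mul, hσA, hσA, AdeleRing.smul_algebraMap,
          ← adeleRingTensorAlgEquiv_tmul_one, smul_adeleRingTensorAlgEquiv_tmul_one, adeleRingTensorAlgEquiv_tmul_one,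
          Algebra.TensorProduct.algebraMap_apply, Algebra.TensorProduct.algebraMap_apply, Algebra.algebraMap_self_apply,
          Algebra.algebraMap_self_apply, ← Algebra.smul_def, ← Algebra.smul_def, TensorProduct.smul_tmul, TensorProduct.smul_tmul, hΘ,
          quotientEquivAlg_comap_smul_one σ τ hτσ J hJ]
  -- Mathlib: norms transported along `(e₁, Θ)`
  have key := Algebra.norm_eq_of_equiv_equiv e₁ Θ he
    (θ₁ (Algebra.TensorProduct.map (AlgHom.id (AdeleRing (𝓞 F) F) (AdeleRing (𝓞 F) F)) (Ideal.Quotient.mkₐ F (J.comap τ)) X))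
  -- `Θ (θ₁ x) = θ₂ ((1 ⊗ τ̄) x) = θ₂ ((1 ⊗ π_J)((1 ⊗ τ) X))`
  have hΘx : Θ (θ₁ (Algebra.TensorProduct.map (AlgHom.id (AdeleRing (𝓞 F) F) (AdeleRing (𝓞 F) F)) (Ideal.Quotient.mkₐ F (J.comap τ)) X)) =
      θ₂ (Algebra.TensorProduct.map (AlgHom.id (AdeleRing (𝓞 F) F) (AdeleRing (𝓞 F) F)) (Ideal.Quotient.mkₐ F J)
        (Algebra.TensorProduct.map (AlgHom.id (AdeleRing (𝓞 F) F) (AdeleRing (𝓞 F) F)) (τ : M →ₐ[F] M) X)) := by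
    change θ₂ (Algebra.TensorProduct.congr (AlgEquiv.refl : AdeleRing (𝓞 F) F ≃ₐ[F] AdeleRing (𝓞 F) F) (Ideal.quotientEquivAlg (J.comap τ) J τ hJ)
      (θ₁.symm (θ₁ _))) = _
    rw [RingEquiv.symm_apply_apply, Algebra.TensorProduct.congr_apply, map_mk_map_eq_map_quotientEquivAlg τ J hJ]
    rfl
  rw [hΘx] at key
  rw [key]
  change _ = σA (σA _)
  rw [hσσ]

end Pairs

/-! ## §2 (N2′) The orbit split of the product of all factor norms -/

section OrbitSplit

/-- **Orbit split for an involution** (pure combinatorics): for an involution `c` of a finite type, a monoid endomorphism `φ` and `ν` with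
`ν (c a) = φ (ν a)`, the product of all `ν a` is the product over the fixed points of `c` (reindexed along any `e : ι ≃ {a ∣ p a}`, `p a ↔ c a = a`)
times `y · φ y`, where `y` is the product over one half of each free orbit (halved by an auxiliary numbering of the type).
[cite: Rogawski1990, §3.5 p. 29–30 (the paired factors)] -/
theorem exists_prod_eq_prod_mul_mul_apply_of_involutive {α : Type} [Fintype α] {R : Type} [CommMonoid R] (c : α → α)
    (hc : Function.Involutive c) (φ : R →* R) (ν : α → R) (hν : ∀ a, ν (c a) = φ (ν a)) (p : α → Prop) (hp : ∀ a, p a ↔ c a = a)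
    {ι : Type} [Fintype ι] (e : ι ≃ {a // p a}) :
    ∃ y : R, ∏ a, ν a = (∏ i, ν (e i)) * (y * φ y) := by
  classical
  -- a numbering of `α` to halve the free orbits
  let f : α → ℕ := fun a => (Fintype.equivFin α a : ℕ)
  have hf : Function.Injective f := fun a b h => (Fintype.equivFin α).injective (Fin.ext h)
  let T : Finset α := Finset.univ.filter fun a => c a ≠ a ∧ f a < f (c a)
  refine ⟨∏ a ∈ T, ν a, ?_⟩
  -- fixed points vs free points
  rw [← Finset.prod_filter_mul_prod_filter_not Finset.univ (fun a => c a = a)]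
  congr 1
  · -- the fixed points, reindexed along `e`
    rw [Finset.prod_subtype (Finset.univ.filter fun a => c a = a) (p := p) (fun a => by simp [hp])]
    exact (Fintype.prod_equiv e (fun i => ν (e i)) (fun a => ν a) fun _ => rfl).symm
  · -- the free points split as `T ⊔ c(T)`
    have hmemT : ∀ a, a ∈ T ↔ c a ≠ a ∧ f a < f (c a) := fun a => by
      simp only [T, Finset.mem_filter, Finset.mem_univ, true_and]
    have hsplit : (Finset.univ.filter fun a => ¬ c a = a) = T ∪ T.image c := by
      ext a
      simp only [Finset.mem_filter, Finset.mem_univ, true_and, Finset.mem_union, Finset.mem_image, hmemT]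
      constructor
      · intro ha
        by_cases hlt : f a < f (c a)
        · exact Or.inl ⟨ha, hlt⟩
        · right
          refine ⟨c a, ⟨?_, ?_⟩, hc a⟩
          · rw [hc a]
            exact fun h => ha h.symm
          · rw [hc a]
            exact lt_of_le_of_ne (not_lt.mp hlt) fun h => ha (hf h)
      · rintro (⟨ha, -⟩ | ⟨b, ⟨hb, -⟩, rfl⟩)
        · exact ha
        · rw [hc b]
          exact fun h => hb h.symm
    have hdisj : Disjoint T (T.image c) := by
      rw [Finset.disjoint_left]
      intro a ha hmem
      rw [hmemT] at ha
      rw [Finset.mem_image] at hmem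
      obtain ⟨b, hb, rfl⟩ := hmem
      rw [hmemT] at hb
      rw [hc b] at ha
      exact lt_asymm ha.2 hb.2
    rw [hsplit, Finset.prod_union hdisj, Finset.prod_image fun x _ y _ h => hc.injective h, map_prod]
    exact congrArg _ (Finset.prod_congr rfl fun a _ => hν a)

variable {F L : Type} [Field F] [NumberField F] [Field L] [NumberField L] [Algebra F L] (σ : L ≃ₐ[F] L)
  (σA : AdeleRing (𝓞 L) L →+* AdeleRing (𝓞 L) L) (hσA : ∀ z, σA z = σ • z)
  {M : Type} [CommRing M] [Algebra F M] [Algebra L M]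
  (τ : M ≃ₐ[F] M) (hτ : ∀ m, τ (τ m) = m) (hτσ : ∀ (ℓ : L) (m : M), τ (ℓ • m) = σ ℓ • τ m)

omit [NumberField F] [NumberField L] in
include hτ in
/-- `τ⁻¹(τ⁻¹ 𝔪) = 𝔪` for an involution `τ`. [cite: CasselsFrohlichANT1967, Ch. VII §7.1] -/
theorem comap_comap_eq_of_involutive (I : Ideal M) : (I.comap τ).comap τ = I := by
  ext m
  simp only [Ideal.mem_comap]
  rw [hτ]

include hσA hτ hτσ in
/-- **(N2′) ORBIT SPLIT OF THE PRODUCT OF ALL FACTOR NORMS.**  For a `τ`-FIXED `X ∈ 𝔸_F ⊗_F M` (`M` a finite product of fields, i.e. `MaxSpec M` finite)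
and any family of transfers `θ_𝔪`: the involution `𝔪 ↦ τ⁻¹𝔪` of `MaxSpec M` conjugates the factor norms by `σ_𝔸` (§1), so
`∏_𝔪 N_{𝔸_L}(θ_𝔪((1 ⊗ π_𝔪) X)) = (∏_i N_{𝔸_L}(θ_{e i}((1 ⊗ π_{e i}) X))) · (y · σ_𝔸 y)` for any reindexing `e : ι ≃ {𝔪 ∣ τ⁻¹𝔪 = 𝔪}` of the `τ`-stable
factors (the letters of ★ `Rogawski1990.cartanIndex`) and some `y ∈ 𝔸_L` — the paired factors contribute an adelic NORM from `L`.
[cite: Rogawski1990, §3.5 Prop. 3.5.2 p. 29–30] [cite: CasselsFrohlichANT1967, Ch. II §19 (19.7); Ch. VII §7.1] -/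
theorem exists_prod_norm_transfer_eq_prod_mul_mul_apply (hσ : σ * σ = 1) [Fintype (MaximalSpectrum M)]
    (θ : ∀ I : MaximalSpectrum M, AdeleRing (𝓞 F) F ⊗[F] (M ⧸ I.asIdeal) ≃+* AdeleRing (𝓞 L) L ⊗[L] (M ⧸ I.asIdeal))
    (hθ : ∀ (I : MaximalSpectrum M) (a : AdeleRing (𝓞 F) F) (m : M ⧸ I.asIdeal), θ I (a ⊗ₜ m) = NumberField.AdeleRing.baseChange F L a ⊗ₜ m)
    (X : AdeleRing (𝓞 F) F ⊗[F] M) (hX : Algebra.TensorProduct.map (AlgHom.id (AdeleRing (𝓞 F) F) (AdeleRing (𝓞 F) F)) (τ : M →ₐ[F] M) X = X)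
    {ι : Type} [Fintype ι] (e : ι ≃ {I : MaximalSpectrum M // I.asIdeal.comap τ = I.asIdeal}) :
    ∃ y : AdeleRing (𝓞 L) L,
      ∏ I : MaximalSpectrum M, Algebra.norm (AdeleRing (𝓞 L) L)
          (θ I (Algebra.TensorProduct.map (AlgHom.id (AdeleRing (𝓞 F) F) (AdeleRing (𝓞 F) F)) (Ideal.Quotient.mkₐ F I.asIdeal) X)) =
        (∏ i : ι, Algebra.norm (AdeleRing (𝓞 L) L)
          (θ (e i).1 (Algebra.TensorProduct.map (AlgHom.id (AdeleRing (𝓞 F) F) (AdeleRing (𝓞 F) F)) (Ideal.Quotient.mkₐ F (e i).1.asIdeal) X))) *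
          (y * σA y) := by
  -- the involution `c 𝔪 := τ⁻¹𝔪` of `MaxSpec M`
  let c : MaximalSpectrum M → MaximalSpectrum M := fun I =>
    ⟨I.asIdeal.comap τ, Ideal.comap_isMaximal_of_surjective τ τ.surjective (K := I.asIdeal) (H := I.isMaximal)⟩
  have hc : Function.Involutive c := fun I => MaximalSpectrum.ext (comap_comap_eq_of_involutive τ hτ I.asIdeal)
  have hσσ : ∀ z, σA (σA z) = z := fun z => by rw [hσA, hσA, ← mul_smul, hσ, one_smul]
  -- the factor norms are `σ_𝔸`-conjugate along `c` (§1 with `(1 ⊗ τ) X = X`)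
  have hν : ∀ I : MaximalSpectrum M,
      Algebra.norm (AdeleRing (𝓞 L) L) (θ (c I) (Algebra.TensorProduct.map (AlgHom.id (AdeleRing (𝓞 F) F) (AdeleRing (𝓞 F) F))
          (Ideal.Quotient.mkₐ F (c I).asIdeal) X)) =
        (σA : AdeleRing (𝓞 L) L →* AdeleRing (𝓞 L) L) (Algebra.norm (AdeleRing (𝓞 L) L)
          (θ I (Algebra.TensorProduct.map (AlgHom.id (AdeleRing (𝓞 F) F) (AdeleRing (𝓞 F) F)) (Ideal.Quotient.mkₐ F I.asIdeal) X))) := by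
    intro I
    have h := norm_transfer_comap_eq σ σA hσA τ hτσ hσ I.asIdeal (θ (c I)) (hθ (c I)) (θ I) (hθ I) X
    rw [hX] at h
    rw [MonoidHom.coe_coe, h, hσσ]
  exact exists_prod_eq_prod_mul_mul_apply_of_involutive c hc (σA : AdeleRing (𝓞 L) L →* AdeleRing (𝓞 L) L) _ hν
    (fun I => I.asIdeal.comap τ = I.asIdeal) (fun I => ⟨fun h => MaximalSpectrum.ext h, fun h => congrArg MaximalSpectrum.asIdeal h⟩) e

end OrbitSplit

end Literature.NumberTheory.GaloisRepresentations

end
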